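import Mathlib
import HarnessLib
import Summits.Ventures.LatticeQCDFlow.Exactness.VMFSiteHeatBath
import Summits.Ventures.LatticeQCDFlow.Exactness.SphereOrbitLaw
import Summits.Ventures.LatticeQCDFlow.Exactness.BestFisherAngle

/-!
# The CP(N−1) site heat bath for EVERY mean direction: the Gaussian perpendicular draw and the assembly are exact

HONEST FRAMING: exact (Metropolis-corrected) sampling algorithms for lattice gauge theory;
figures of merit are autocorrelation/cost numbers at stated couplings and volumes; no
continuum-physics claim.

Venture `LatticeQCDFlow` (cell pub-lqcd), topic `Exactness`, FANOUT row 9 (eng-latcore, the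
engine `latflow.core`).  NEW WORK of the cell over Mathlib (`stdGaussian`, `stdGaussian_map`) and
row 9's `VMFSiteHeatBath.lean` (the `m = e₀` assembly), `SphereOrbitLaw.lean` (orthogonal matrices
act on the sphere; the direction map is equivariant; the Gaussian is invariant), `StdGaussianRadial.lean`
(Muller: the direction of a standard Gaussian vector is uniform) and row 7's
`SphereAxisCoordinates.lean`.  Nothing is cited as a fact.  Printed counterparts, NAMED ONLY:
Wood 1994; Muller 1959; Mardia–Jupp §9.3.

`VMFSiteHeatBath.lean` proved the site heat bath of `cpn_2d` exact for the mean direction `m = e₀`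
and an abstract uniform perpendicular direction, and listed as NOT CLAIMED "mean directions
`m ≠ e₀` (one rotation away)" and "how the engine draws `v` (a Gaussian projected orthogonally to
`m` and normalised)".  This file closes both.  `csrc/cpn_kernel.c` `site_heatbath` (mode 0) and
`cpn_2d.py` `heatbath_sites`, in idealised real arithmetic on `ℝ^{n+2} = ℝ^{2N}` (the realified
`ℂ^N`, real inner product `Re(m†z)`): draw `w` by Wood's loop, draw a standard Gaussian `ξ`, set
`v = (ξ − ⟪m,ξ⟫ m)/‖ξ − ⟪m,ξ⟫ m‖` and `z = w m + √(1−w²) v`.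

* `vmfAt κ m` — the von Mises–Fisher law with mean direction `m`: density `e^{κ⟪m,x⟫}` against
  `volume.toSphere`; `vmfAt_polarAxis` — at `m = e₀` it is `vmfSphere κ n`; **`vmfAt_map_actS`** —
  an orthogonal matrix `A` pushes `vmfAt κ m` to `vmfAt κ (A m)` (surface measure invariant, inner
  product preserved);
* `perpDir m ξ`, `siteHB m w ξ` — the engine's perpendicular direction and assembled site (as points
  of the sphere); `siteHB_polarAxis` — in the axis frame `ξ = t e₀ + (0, y)`, `y ≠ 0`, `|w| ≤ 1`:
  `siteHB e₀ w ξ = latitudePt n (arccos w) (y/‖y‖)`; `siteHB_rot` — equivariance under orthogonal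
  matrices;
* `stdGaussian_map_axisCoords` — `N(0, I_{n+2}) = N(0,1) ⊗ N(0, I_{n+1})` in axis coordinates;
  `stdGaussian_map_dirSphere_axisCoords_snd` — the direction of the equatorial part of `ξ ∼ N(0, I)`
  is uniform on `Sⁿ` (Muller); **`map_siteHB_polarAxis`** — THE GAUSSIAN PERPENDICULAR DRAW IS EXACT:
  with `ξ ∼ N(0, I)` independent of Wood's `w`, the assembled site has EXACTLY the normalised vMF law
  (`m = e₀`);
* **`map_siteHB`** — THE SITE HEAT BATH IS EXACT FOR EVERY MEAN DIRECTION `m ∈ S^{n+1}` (`κ ≥ 0`,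
  `n ≥ 1`, i.e. real dimension `≥ 3` — every `N ≥ 2`):
  `((loopLaw (woodRound κ (n+1))) ⊗ stdGaussian).map (siteHB m) = (vmfAt κ m univ)⁻¹ • vmfAt κ m`.

NOT CLAIMED: the Beta/Gamma/Gaussian generators feeding Wood's loop and `ξ` (separate files:
`BetaFromGammas.lean`, the Marsaglia–Tsang and Box–Muller/Marsaglia-polar files), `κ = 2Nβ‖F‖` and
`m = F/‖F‖` as functions of the neighbours (LAW side, `Scoring/`), the `‖F‖ ≤ 1e−300` guard, the
OVER-heat-bath mode 1 (`OverHeatBath.lean`), floating point.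
-/

namespace Summit.Ventures.LatticeQCDFlow.Exactness

open MeasureTheory Measure Metric Set Real ProbabilityTheory WithLp Matrix
open scoped ENNReal InnerProductSpace

section GeneralAxis

variable (n : ℕ)

/-! ## §1 The vMF law with a general mean direction -/

/-- **The von Mises–Fisher law on `S^{n+1}` with mean-direction parameter `m`** (unnormalised:
density `e^{κ⟪m,x⟫}` against `volume.toSphere`; `m` need not be a unit vector here). -/
noncomputable def vmfAt (κ : ℝ) (m : EuclideanSpace ℝ (Fin (n + 2))) :
    Measure (sphere (0 : EuclideanSpace ℝ (Fin (n + 2))) 1) :=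
  ((volume : Measure (EuclideanSpace ℝ (Fin (n + 2)))).toSphere).withDensity
    fun x => ENNReal.ofReal (Real.exp (κ * ⟪m, (x : EuclideanSpace ℝ (Fin (n + 2)))⟫_ℝ))

/-- At `m = e₀` this is `vmfSphere κ n` (density `e^{κ x₀}`). -/
theorem vmfAt_polarAxis (κ : ℝ) : vmfAt n κ (polarAxis n) = vmfSphere κ n := by
  unfold vmfAt vmfSphere
  congr 1
  funext x
  rw [inner_polarAxis]

/-- The density `x ↦ e^{κ⟪m,x⟫}` is measurable on the sphere. -/
theorem measurable_vmfDensity (κ : ℝ) (m : EuclideanSpace ℝ (Fin (n + 2))) :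
    Measurable fun x : sphere (0 : EuclideanSpace ℝ (Fin (n + 2))) 1 =>
      ENNReal.ofReal (Real.exp (κ * ⟪m, (x : EuclideanSpace ℝ (Fin (n + 2)))⟫_ℝ)) :=
  (measurable_const.mul (measurable_const.inner measurable_subtype_coe)).exp.ennreal_ofReal

/-- The action of an orthogonal matrix on the sphere is measurable. -/
theorem measurable_actS {A : Matrix (Fin (n + 2)) (Fin (n + 2)) ℝ} (hA : A ∈ Matrix.orthogonalGroup (Fin (n + 2)) ℝ) :
    Measurable (actS A hA) :=
  ((rotIso A hA).continuous.comp continuous_subtype_val).measurable.subtype_mk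

/-- **The surface measure is invariant under every orthogonal matrix.** -/
theorem toSphere_map_actS {A : Matrix (Fin (n + 2)) (Fin (n + 2)) ℝ} (hA : A ∈ Matrix.orthogonalGroup (Fin (n + 2)) ℝ) :
    ((volume : Measure (EuclideanSpace ℝ (Fin (n + 2)))).toSphere).map (actS A hA) =
      (volume : Measure (EuclideanSpace ℝ (Fin (n + 2)))).toSphere := by
  have hC0 := toSphere_univ_ne_zero (volume : Measure (EuclideanSpace ℝ (Fin (n + 2))))
  have hCt : ((volume : Measure (EuclideanSpace ℝ (Fin (n + 2)))).toSphere univ) ≠ ∞ := measure_ne_top _ _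
  have h := uniformSphere_map_actS (m := Fin (n + 2)) hA
  rw [uniformSphere, Measure.map_smul] at h
  have h' := congrArg (fun μ => ((volume : Measure (EuclideanSpace ℝ (Fin (n + 2)))).toSphere univ) • μ) h
  simp only [smul_smul, ENNReal.mul_inv_cancel hC0 hCt, one_smul] at h'
  exact h'

/-- **An orthogonal matrix pushes `vmfAt κ m` forward to `vmfAt κ (A m)`.** -/
theorem vmfAt_map_actS (κ : ℝ) (m : EuclideanSpace ℝ (Fin (n + 2)))
    {A : Matrix (Fin (n + 2)) (Fin (n + 2)) ℝ} (hA : A ∈ Matrix.orthogonalGroup (Fin (n + 2)) ℝ) :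
    (vmfAt n κ m).map (actS A hA) = vmfAt n κ (rotIso A hA m) := by
  have hW := measurable_vmfDensity n κ (rotIso A hA m)
  have hdens : (fun x : sphere (0 : EuclideanSpace ℝ (Fin (n + 2))) 1 =>
      ENNReal.ofReal (Real.exp (κ * ⟪m, (x : EuclideanSpace ℝ (Fin (n + 2)))⟫_ℝ))) =
      fun x => ENNReal.ofReal (Real.exp (κ * ⟪rotIso A hA m,
        ((actS A hA x : sphere (0 : EuclideanSpace ℝ (Fin (n + 2))) 1) : EuclideanSpace ℝ (Fin (n + 2)))⟫_ℝ)) := by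
    funext x
    rw [coe_actS, ← rotIso_apply hA, LinearIsometryEquiv.inner_map_map]
  rw [vmfAt, hdens, map_withDensity_comp _ (measurable_actS n hA) hW, toSphere_map_actS n hA, vmfAt]

/-- Total mass is preserved: `vmfAt κ (A m) univ = vmfAt κ m univ`. -/
theorem vmfAt_rot_univ (κ : ℝ) (m : EuclideanSpace ℝ (Fin (n + 2)))
    {A : Matrix (Fin (n + 2)) (Fin (n + 2)) ℝ} (hA : A ∈ Matrix.orthogonalGroup (Fin (n + 2)) ℝ) :
    vmfAt n κ (rotIso A hA m) univ = vmfAt n κ m univ := by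
  rw [← vmfAt_map_actS n κ m hA, Measure.map_apply (measurable_actS n hA) MeasurableSet.univ, preimage_univ]

/-! ## §2 The engine's perpendicular direction and assembled site -/

/-- **The engine's perpendicular direction**: project `ξ` orthogonally to `m` (real inner product)
and normalise. -/
noncomputable def perpDir (m ξ : EuclideanSpace ℝ (Fin (n + 2))) : sphere (0 : EuclideanSpace ℝ (Fin (n + 2))) 1 :=
  dirSphere (ξ - ⟪m, ξ⟫_ℝ • m)

/-- **The engine's assembled site** `z = w m + √(1−w²) v` (as a point of the sphere: the direction
of that vector, which is a unit vector whenever `|w| ≤ 1` and `v ⊥ m`). -/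
noncomputable def siteHB (m : EuclideanSpace ℝ (Fin (n + 2))) (w : ℝ) (ξ : EuclideanSpace ℝ (Fin (n + 2))) :
    sphere (0 : EuclideanSpace ℝ (Fin (n + 2))) 1 :=
  dirSphere (w • m + Real.sqrt (1 - w ^ 2) • (perpDir n m ξ : EuclideanSpace ℝ (Fin (n + 2))))

/-- `perpDir m` is measurable. -/
theorem measurable_perpDir (m : EuclideanSpace ℝ (Fin (n + 2))) : Measurable (perpDir n m) := by
  have hc : Measurable fun ξ : EuclideanSpace ℝ (Fin (n + 2)) => ξ - ⟪m, ξ⟫_ℝ • m :=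
    measurable_id.sub (((measurable_const (a := m)).inner measurable_id).smul_const m)
  unfold perpDir
  exact measurable_dirSphere.comp hc

/-- `siteHB m` is jointly measurable in `(w, ξ)`. -/
theorem measurable_siteHB (m : EuclideanSpace ℝ (Fin (n + 2))) :
    Measurable fun p : ℝ × EuclideanSpace ℝ (Fin (n + 2)) => siteHB n m p.1 p.2 := by
  unfold siteHB
  refine measurable_dirSphere.comp ?_
  have h1 : Measurable fun p : ℝ × EuclideanSpace ℝ (Fin (n + 2)) =>
      (perpDir n m p.2 : EuclideanSpace ℝ (Fin (n + 2))) :=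
    measurable_subtype_coe.comp ((measurable_perpDir n m).comp measurable_snd)
  have h2 : Measurable fun p : ℝ × EuclideanSpace ℝ (Fin (n + 2)) => Real.sqrt (1 - p.1 ^ 2) :=
    (Real.continuous_sqrt.comp (continuous_const.sub (continuous_fst.pow 2))).measurable
  exact (measurable_fst.smul measurable_const).add (h2.smul h1)

/-! ## §3 The axis frame: `ξ = t e₀ + (0, y)` -/

/-- `⟪e₀, t e₀ + (0, y)⟫ = t`. -/
theorem inner_polarAxis_axisCoords_symm (t : ℝ) (y : EuclideanSpace ℝ (Fin (n + 1))) :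
    ⟪polarAxis n, (axisCoords n).symm (t, y)⟫_ℝ = t := by
  rw [axisCoords_symm_apply_eq, inner_add_right, real_inner_smul_right, real_inner_self_eq_norm_sq,
    norm_polarAxis, one_pow, mul_one, inner_polarAxis_equatorEmbed, add_zero]

/-- The orthogonal projection of `t e₀ + (0, y)` off the axis is `(0, y)`. -/
theorem perp_axisCoords_symm (t : ℝ) (y : EuclideanSpace ℝ (Fin (n + 1))) :
    (axisCoords n).symm (t, y) - ⟪polarAxis n, (axisCoords n).symm (t, y)⟫_ℝ • polarAxis n = equatorEmbed n y := by
  rw [inner_polarAxis_axisCoords_symm, axisCoords_symm_apply_eq, add_sub_cancel_left]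

/-- The direction of `(0, y)` is `(0, y/‖y‖)` (`y ≠ 0`). -/
theorem coe_dirSphere_equatorEmbed {y : EuclideanSpace ℝ (Fin (n + 1))} (hy : y ≠ 0) :
    (dirSphere (equatorEmbed n y) : EuclideanSpace ℝ (Fin (n + 2))) =
      equatorEmbed n (dirSphere y : EuclideanSpace ℝ (Fin (n + 1))) := by
  have hEy : equatorEmbed n y ≠ 0 := by
    rw [← norm_ne_zero_iff, norm_equatorEmbed, norm_ne_zero_iff]; exact hy
  rw [dirSphere_coe hEy, dirSphere_coe hy, norm_equatorEmbed, LinearIsometry.map_smul]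

/-- In the axis frame the engine's perpendicular direction is `(0, y/‖y‖)`. -/
theorem perpDir_polarAxis {y : EuclideanSpace ℝ (Fin (n + 1))} (hy : y ≠ 0) (t : ℝ) :
    (perpDir n (polarAxis n) ((axisCoords n).symm (t, y)) : EuclideanSpace ℝ (Fin (n + 2))) =
      equatorEmbed n (dirSphere y : EuclideanSpace ℝ (Fin (n + 1))) := by
  rw [perpDir, perp_axisCoords_symm, coe_dirSphere_equatorEmbed n hy]

/-- In the axis frame the assembled VECTOR is the latitude point `cos(arccos w) e₀ + sin(arccos w) (0, y/‖y‖)`. -/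
theorem assembled_eq_latitudePt {y : EuclideanSpace ℝ (Fin (n + 1))} (hy : y ≠ 0) (t : ℝ) {w : ℝ}
    (hw : w ∈ Icc (-1 : ℝ) 1) :
    w • polarAxis n + Real.sqrt (1 - w ^ 2) •
        (perpDir n (polarAxis n) ((axisCoords n).symm (t, y)) : EuclideanSpace ℝ (Fin (n + 2))) =
      (latitudePt n (Real.arccos w) (dirSphere y) : EuclideanSpace ℝ (Fin (n + 2))) := by
  rw [perpDir_polarAxis n hy, coe_latitudePt, Real.cos_arccos hw.1 hw.2, Real.sin_arccos]

/-- **In the axis frame the engine's assembled site is the latitude point**: for `y ≠ 0`, `|w| ≤ 1`,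
`siteHB e₀ w (t e₀ + (0,y)) = latitudePt n (arccos w) (y/‖y‖)`. -/
theorem siteHB_polarAxis {y : EuclideanSpace ℝ (Fin (n + 1))} (hy : y ≠ 0) (t : ℝ) {w : ℝ}
    (hw : w ∈ Icc (-1 : ℝ) 1) :
    siteHB n (polarAxis n) w ((axisCoords n).symm (t, y)) = latitudePt n (Real.arccos w) (dirSphere y) := by
  unfold siteHB
  rw [assembled_eq_latitudePt n hy t hw, dirSphere_coe_sphere]

/-! ## §4 Equivariance under orthogonal matrices -/

/-- The perpendicular direction is equivariant: `perpDir (A m) (A ξ) = A · perpDir m ξ` off the axis. -/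
theorem perpDir_rot {A : Matrix (Fin (n + 2)) (Fin (n + 2)) ℝ} (hA : A ∈ Matrix.orthogonalGroup (Fin (n + 2)) ℝ)
    {m ξ : EuclideanSpace ℝ (Fin (n + 2))} (h : ξ - ⟪m, ξ⟫_ℝ • m ≠ 0) :
    perpDir n (rotIso A hA m) (rotIso A hA ξ) = actS A hA (perpDir n m ξ) := by
  unfold perpDir
  have hlin : rotIso A hA ξ - ⟪rotIso A hA m, rotIso A hA ξ⟫_ℝ • rotIso A hA m = rotIso A hA (ξ - ⟪m, ξ⟫_ℝ • m) := by
    rw [LinearIsometryEquiv.inner_map_map, map_sub, LinearIsometryEquiv.map_smul]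
  rw [hlin, dirSphere_rotIso hA h]

/-- The assembled site is equivariant: `siteHB (A m) w (A ξ) = A · siteHB m w ξ` whenever the
projection and the assembled vector are non-zero. -/
theorem siteHB_rot {A : Matrix (Fin (n + 2)) (Fin (n + 2)) ℝ} (hA : A ∈ Matrix.orthogonalGroup (Fin (n + 2)) ℝ)
    {m ξ : EuclideanSpace ℝ (Fin (n + 2))} {w : ℝ} (h1 : ξ - ⟪m, ξ⟫_ℝ • m ≠ 0)
    (h2 : w • m + Real.sqrt (1 - w ^ 2) • (perpDir n m ξ : EuclideanSpace ℝ (Fin (n + 2))) ≠ 0) :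
    siteHB n (rotIso A hA m) w (rotIso A hA ξ) = actS A hA (siteHB n m w ξ) := by
  unfold siteHB
  rw [perpDir_rot n hA h1, coe_actS, ← rotIso_apply hA]
  have hlin : w • rotIso A hA m + Real.sqrt (1 - w ^ 2) •
      rotIso A hA (perpDir n m ξ : EuclideanSpace ℝ (Fin (n + 2))) =
      rotIso A hA (w • m + Real.sqrt (1 - w ^ 2) • (perpDir n m ξ : EuclideanSpace ℝ (Fin (n + 2)))) := by
    rw [map_add, LinearIsometryEquiv.map_smul, LinearIsometryEquiv.map_smul]
  rw [hlin, dirSphere_rotIso hA h2]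

/-- In the axis frame both non-degeneracy conditions hold: the projection is `(0, y) ≠ 0` … -/
theorem perp_ne_zero_polarAxis {y : EuclideanSpace ℝ (Fin (n + 1))} (hy : y ≠ 0) (t : ℝ) :
    (axisCoords n).symm (t, y) - ⟪polarAxis n, (axisCoords n).symm (t, y)⟫_ℝ • polarAxis n ≠ 0 := by
  rw [perp_axisCoords_symm, ← norm_ne_zero_iff, norm_equatorEmbed, norm_ne_zero_iff]
  exact hy

/-- … and the assembled vector is a unit vector, hence non-zero (`|w| ≤ 1`). -/
theorem assembled_ne_zero_polarAxis {y : EuclideanSpace ℝ (Fin (n + 1))} (hy : y ≠ 0) (t : ℝ) {w : ℝ}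
    (hw : w ∈ Icc (-1 : ℝ) 1) :
    w • polarAxis n + Real.sqrt (1 - w ^ 2) •
      (perpDir n (polarAxis n) ((axisCoords n).symm (t, y)) : EuclideanSpace ℝ (Fin (n + 2))) ≠ 0 := by
  rw [assembled_eq_latitudePt n hy t hw]
  exact ne_zero_of_mem_unit_sphere _

/-! ## §5 The Gaussian in axis coordinates -/

/-- `axisCoords ∘ toLp = (id × toLp) ∘ piFinSuccAbove 0` on coordinate vectors. -/
theorem axisCoords_comp_toLp :
    (axisCoords n : EuclideanSpace ℝ (Fin (n + 2)) → ℝ × EuclideanSpace ℝ (Fin (n + 1))) ∘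
        (toLp 2 : (Fin (n + 2) → ℝ) → EuclideanSpace ℝ (Fin (n + 2))) =
      Prod.map id (toLp 2 : (Fin (n + 1) → ℝ) → EuclideanSpace ℝ (Fin (n + 1))) ∘
        MeasurableEquiv.piFinSuccAbove (fun _ : Fin (n + 2) => ℝ) 0 := by
  funext x
  rfl

/-- **`N(0, I_{n+2})` in axis coordinates is `N(0,1) ⊗ N(0, I_{n+1})`.** -/
theorem stdGaussian_map_axisCoords :
    (stdGaussian (EuclideanSpace ℝ (Fin (n + 2)))).map (axisCoords n) =
      (gaussianReal 0 1).prod (stdGaussian (EuclideanSpace ℝ (Fin (n + 1)))) := by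
  have htoLp : Measurable (toLp 2 : (Fin (n + 1) → ℝ) → EuclideanSpace ℝ (Fin (n + 1))) := measurable_toLp 2 _
  rw [← map_pi_eq_stdGaussian, Measure.map_map (axisCoords n).measurable (measurable_toLp 2 _),
    axisCoords_comp_toLp, ← Measure.map_map (measurable_id.prodMap htoLp) (MeasurableEquiv.measurable _),
    (measurePreserving_piFinSuccAbove (fun _ : Fin (n + 2) => gaussianReal 0 1) 0).map_eq,
    ← Measure.map_prod_map _ _ measurable_id htoLp, Measure.map_id, map_pi_eq_stdGaussian]

/-- Under `N(0, I_{n+2})` the equatorial part `y` of `ξ` is almost surely non-zero. -/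
theorem ae_axisCoords_snd_ne_zero :
    ∀ᵐ ξ ∂(stdGaussian (EuclideanSpace ℝ (Fin (n + 2)))), (axisCoords n ξ).2 ≠ 0 := by
  rw [ae_iff]
  simp only [ne_eq, not_not]
  have hset : {ξ : EuclideanSpace ℝ (Fin (n + 2)) | (axisCoords n ξ).2 = 0} =
      axisCoords n ⁻¹' (univ ×ˢ {(0 : EuclideanSpace ℝ (Fin (n + 1)))}) := by
    ext ξ; simp
  rw [hset, ← Measure.map_apply (axisCoords n).measurable (MeasurableSet.univ.prod (measurableSet_singleton _)),
    stdGaussian_map_axisCoords, Measure.prod_prod, stdGaussian_singleton_zero', mul_zero]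

/-- **Muller in the axis frame**: the direction of the equatorial part of `ξ ∼ N(0, I_{n+2})` is
uniform on `Sⁿ`. -/
theorem stdGaussian_map_dirSphere_axisCoords_snd :
    (stdGaussian (EuclideanSpace ℝ (Fin (n + 2)))).map
        (fun ξ => dirSphere (axisCoords n ξ).2) =
      uniformSphere (volume : Measure (EuclideanSpace ℝ (Fin (n + 1)))) := by
  rw [show (fun ξ : EuclideanSpace ℝ (Fin (n + 2)) => dirSphere (axisCoords n ξ).2) =
      (dirSphere ∘ Prod.snd) ∘ axisCoords n from rfl,
    ← Measure.map_map (measurable_dirSphere.comp measurable_snd) (axisCoords n).measurable,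
    stdGaussian_map_axisCoords, ← Measure.map_map measurable_dirSphere measurable_snd,
    Measure.map_snd_prod, measure_univ, one_smul, stdGaussian_map_dirSphere (Fin (n + 1))]

/-! ## §6 The site heat bath is exact: axis frame, then every mean direction -/

variable {n}

/-- Wood's loop outputs cosines in `(−1, 1)` almost surely. -/
theorem ae_loopLaw_woodRound_mem {κ : ℝ} (hκ : 0 ≤ κ) {δ : ℝ} (hδ : 0 < δ) :
    ∀ᵐ w ∂(loopLaw (woodRound κ δ)), w ∈ Ioo (-1 : ℝ) 1 := by
  rw [loopLaw_woodRound hκ hδ]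
  refine ae_smul_measure ?_ _
  rw [vmfCosLaw]
  exact (ae_restrict_mem measurableSet_Ioo).filter_mono (withDensity_absolutelyContinuous _ _).ae_le

/-- **THE SITE HEAT BATH WITH THE GAUSSIAN PERPENDICULAR DRAW IS EXACT (axis frame).**  For `κ ≥ 0`,
`n ≥ 1`: Wood's cosine `w`, an independent `ξ ∼ N(0, I_{n+2})`, `v = (ξ − ⟪e₀,ξ⟫e₀)/‖·‖` and
`z = w e₀ + √(1−w²) v` give EXACTLY the normalised von Mises–Fisher law `vmfSphere κ n`. -/
theorem map_siteHB_polarAxis {κ : ℝ} (hκ : 0 ≤ κ) (hn : 1 ≤ n) :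
    ((loopLaw (woodRound κ (n + 1))).prod (stdGaussian (EuclideanSpace ℝ (Fin (n + 2))))).map
        (fun p : ℝ × EuclideanSpace ℝ (Fin (n + 2)) => siteHB n (polarAxis n) p.1 p.2) =
      ((vmfSphere κ n) univ)⁻¹ • vmfSphere κ n := by
  haveI := isProbabilityMeasure_loopLaw_woodRound hκ (by positivity : (0 : ℝ) < n + 1)
  have hδ : (0 : ℝ) < (n : ℝ) + 1 := by positivity
  -- a.e. the engine's map is the latitude map of (arccos w, direction of the equatorial part of ξ)
  have hae : (fun p : ℝ × EuclideanSpace ℝ (Fin (n + 2)) => siteHB n (polarAxis n) p.1 p.2) =ᵐ[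
      (loopLaw (woodRound κ (n + 1))).prod (stdGaussian (EuclideanSpace ℝ (Fin (n + 2))))]
      (fun p => latitudePt n (Real.arccos p.1) (dirSphere (axisCoords n p.2).2)) := by
    have h1 : ∀ᵐ p ∂((loopLaw (woodRound κ (n + 1))).prod (stdGaussian (EuclideanSpace ℝ (Fin (n + 2))))),
        p.1 ∈ Ioo (-1 : ℝ) 1 :=
      (quasiMeasurePreserving_fst (μ := loopLaw (woodRound κ (n + 1)))
        (ν := stdGaussian (EuclideanSpace ℝ (Fin (n + 2))))).ae (ae_loopLaw_woodRound_mem hκ hδ)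
    have h2 : ∀ᵐ p ∂((loopLaw (woodRound κ (n + 1))).prod (stdGaussian (EuclideanSpace ℝ (Fin (n + 2))))),
        (axisCoords n p.2).2 ≠ 0 :=
      (quasiMeasurePreserving_snd (μ := loopLaw (woodRound κ (n + 1)))
        (ν := stdGaussian (EuclideanSpace ℝ (Fin (n + 2))))).ae (ae_axisCoords_snd_ne_zero n)
    filter_upwards [h1, h2] with p hp1 hp2
    have hξ : p.2 = (axisCoords n).symm ((axisCoords n p.2).1, (axisCoords n p.2).2) := by
      rw [Prod.mk.eta, MeasurableEquiv.symm_apply_apply]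
    rw [hξ, siteHB_polarAxis n hp2 _ ⟨hp1.1.le, hp1.2.le⟩, MeasurableEquiv.apply_symm_apply]
  have hdir : Measurable fun ξ : EuclideanSpace ℝ (Fin (n + 2)) => dirSphere (axisCoords n ξ).2 :=
    measurable_dirSphere.comp (measurable_snd.comp (axisCoords n).measurable)
  -- (transported along a `simp` equation: unifying through `latitudePt`/`dirSphere` by `whnf` times out)
  have hLeq : ((fun p : ℝ × sphere (0 : EuclideanSpace ℝ (Fin (n + 1))) 1 => latitudePt n p.1 p.2) ∘
      Prod.map Real.arccos id) =
      fun p : ℝ × sphere (0 : EuclideanSpace ℝ (Fin (n + 1))) 1 => latitudePt n (Real.arccos p.1) p.2 := by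
    funext p
    simp only [Function.comp_apply, Prod.map_fst, Prod.map_snd, id_eq]
  have hL : Measurable fun p : ℝ × sphere (0 : EuclideanSpace ℝ (Fin (n + 1))) 1 =>
      latitudePt n (Real.arccos p.1) p.2 := by
    rw [← hLeq]
    exact (measurable_latitudePt n).comp (Real.measurable_arccos.prodMap measurable_id)
  have hcomp : (fun p : ℝ × EuclideanSpace ℝ (Fin (n + 2)) =>
      latitudePt n (Real.arccos p.1) (dirSphere (axisCoords n p.2).2)) =
      (fun p : ℝ × sphere (0 : EuclideanSpace ℝ (Fin (n + 1))) 1 => latitudePt n (Real.arccos p.1) p.2) ∘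
        Prod.map id (fun ξ : EuclideanSpace ℝ (Fin (n + 2)) => dirSphere (axisCoords n ξ).2) := by
    funext p
    simp only [Function.comp_apply, Prod.map_fst, Prod.map_snd, id_eq]
  refine (Measure.map_congr hae).trans ?_
  rw [hcomp, ← Measure.map_map hL (measurable_id.prodMap hdir), ← Measure.map_prod_map _ _ measurable_id hdir,
    Measure.map_id, stdGaussian_map_dirSphere_axisCoords_snd]
  exact map_siteHeatBath_eq_vmfSphere hκ hn

/-- **THE CP(N−1) SITE HEAT BATH IS EXACT FOR EVERY MEAN DIRECTION.**  For `κ ≥ 0`, `n ≥ 1` and every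
unit vector `m ∈ S^{n+1}`: Wood's cosine `w`, an independent standard Gaussian `ξ`, the engine's
`v = (ξ − ⟪m,ξ⟫m)/‖ξ − ⟪m,ξ⟫m‖` and `z = w m + √(1−w²) v` give EXACTLY the normalised von Mises–Fisher
law with mean direction `m`: `(vmfAt κ m univ)⁻¹ • vmfAt κ m`. -/
theorem map_siteHB {κ : ℝ} (hκ : 0 ≤ κ) (hn : 1 ≤ n)
    (m : sphere (0 : EuclideanSpace ℝ (Fin (n + 2))) 1) :
    ((loopLaw (woodRound κ (n + 1))).prod (stdGaussian (EuclideanSpace ℝ (Fin (n + 2))))).map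
        (fun p : ℝ × EuclideanSpace ℝ (Fin (n + 2)) =>
          siteHB n (m : EuclideanSpace ℝ (Fin (n + 2))) p.1 p.2) =
      ((vmfAt n κ m) univ)⁻¹ • vmfAt n κ m := by
  haveI := isProbabilityMeasure_loopLaw_woodRound hκ (by positivity : (0 : ℝ) < n + 1)
  have hδ : (0 : ℝ) < (n : ℝ) + 1 := by positivity
  -- a rotation taking `e₀` to `m`
  have h2 : 2 ≤ Fintype.card (Fin (n + 2)) := by rw [Fintype.card_fin]; omega
  let e₀ : sphere (0 : EuclideanSpace ℝ (Fin (n + 2))) 1 :=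
    ⟨polarAxis n, by rw [mem_sphere_zero_iff_norm, norm_polarAxis]⟩
  obtain ⟨O, hO⟩ := exists_actSO_eq h2 e₀ m
  have hA := mem_orthogonalGroup_of_SO O
  have hm : (m : EuclideanSpace ℝ (Fin (n + 2))) = rotIso (O : Matrix (Fin (n + 2)) (Fin (n + 2)) ℝ) hA (polarAxis n) := by
    rw [← hO]; rfl
  -- equivariance, almost everywhere
  have hae : (fun p : ℝ × EuclideanSpace ℝ (Fin (n + 2)) =>
      siteHB n (m : EuclideanSpace ℝ (Fin (n + 2))) p.1 (rotIso (O : Matrix (Fin (n + 2)) (Fin (n + 2)) ℝ) hA p.2)) =ᵐ[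
      (loopLaw (woodRound κ (n + 1))).prod (stdGaussian (EuclideanSpace ℝ (Fin (n + 2))))]
      (actS (O : Matrix (Fin (n + 2)) (Fin (n + 2)) ℝ) hA ∘
        fun p => siteHB n (polarAxis n) p.1 p.2) := by
    have h1 : ∀ᵐ p ∂((loopLaw (woodRound κ (n + 1))).prod (stdGaussian (EuclideanSpace ℝ (Fin (n + 2))))),
        p.1 ∈ Ioo (-1 : ℝ) 1 :=
      (quasiMeasurePreserving_fst (μ := loopLaw (woodRound κ (n + 1)))
        (ν := stdGaussian (EuclideanSpace ℝ (Fin (n + 2))))).ae (ae_loopLaw_woodRound_mem hκ hδ)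
    have h2' : ∀ᵐ p ∂((loopLaw (woodRound κ (n + 1))).prod (stdGaussian (EuclideanSpace ℝ (Fin (n + 2))))),
        (axisCoords n p.2).2 ≠ 0 :=
      (quasiMeasurePreserving_snd (μ := loopLaw (woodRound κ (n + 1)))
        (ν := stdGaussian (EuclideanSpace ℝ (Fin (n + 2))))).ae (ae_axisCoords_snd_ne_zero n)
    filter_upwards [h1, h2'] with p hp1 hp2
    have hw : p.1 ∈ Icc (-1 : ℝ) 1 := ⟨hp1.1.le, hp1.2.le⟩
    have hξ : p.2 = (axisCoords n).symm ((axisCoords n p.2).1, (axisCoords n p.2).2) := by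
      rw [Prod.mk.eta, MeasurableEquiv.symm_apply_apply]
    rw [Function.comp_apply, hm, hξ]
    exact siteHB_rot n hA (perp_ne_zero_polarAxis n hp2 _) (assembled_ne_zero_polarAxis n hp2 _ hw)
  have hR : Measurable (rotIso (O : Matrix (Fin (n + 2)) (Fin (n + 2)) ℝ) hA) :=
    (rotIso (O : Matrix (Fin (n + 2)) (Fin (n + 2)) ℝ) hA).continuous.measurable
  -- transport the Gaussian by the rotation, then the axis-frame theorem, then rotate the vMF law
  have hcomp : (fun p : ℝ × EuclideanSpace ℝ (Fin (n + 2)) =>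
      siteHB n (m : EuclideanSpace ℝ (Fin (n + 2))) p.1 p.2) ∘
        Prod.map id (rotIso (O : Matrix (Fin (n + 2)) (Fin (n + 2)) ℝ) hA) =
      fun p => siteHB n (m : EuclideanSpace ℝ (Fin (n + 2))) p.1
        (rotIso (O : Matrix (Fin (n + 2)) (Fin (n + 2)) ℝ) hA p.2) := by
    funext p
    simp only [Function.comp_apply, Prod.map_fst, Prod.map_snd, id_eq]
  rw [← stdGaussian_map (rotIso (O : Matrix (Fin (n + 2)) (Fin (n + 2)) ℝ) hA),
    ← Measure.map_id (μ := loopLaw (woodRound κ (n + 1))),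
    Measure.map_prod_map _ _ measurable_id hR,
    Measure.map_map (measurable_siteHB n _) (measurable_id.prodMap hR), hcomp]
  refine (Measure.map_congr hae).trans ?_
  rw [← Measure.map_map (measurable_actS n hA) (measurable_siteHB n _),
    map_siteHB_polarAxis hκ hn, Measure.map_smul, ← vmfAt_polarAxis, vmfAt_map_actS n κ _ hA,
    ← vmfAt_rot_univ n κ (polarAxis n) hA, ← hm]

end GeneralAxis

end Summit.Ventures.LatticeQCDFlow.Exactness
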